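import Mathlib
import HarnessLib
import Summits.CriticalPhenomena.CardyFormulaZ2.Theses.CardySelfRefinement
import Literature.Probability.RandomPlanarGeometry.ConformalRectangle
import Literature.Probability.RandomPlanarGeometry.RadoContinuity
import Literature.Probability.RandomPlanarGeometry.MoebiusMatching
import Literature.Probability.RandomPlanarGeometry.HalfPlaneAutomorphism
import Literature.Probability.RandomPlanarGeometry.MarkedDomainCorners
import Literature.Probability.RandomPlanarGeometry.PlanarDomainsTopology

/-!
# Crux `SymmetryUpgradeR` (stmt-CriticalPhenomena-17239), line `SketchIdeatorTwo` — helper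
# `exitRigidity_imageDataOfModulus` for stub `stub_exitRigidity` (FL4)

**Two conformal rectangles with the same modulus and the same boundary orientation are univalent
images of one another, vertices and sides corresponding, by a map of the whole plane**
(Pommerenke 1992, §2.3 Exercise 2 "every quadrilateral is conformally equivalent to a rectangle,
the vertices corresponding", with Thm. 2.6; Ahlfors 1979, Ch. 3 §3 and Ch. 6 §1.1), in the
image-data form consumed by `exitRigidity_exitFunction`: given uniformizing data `(φ, x)` of `R`
and `(ψ, y)` of `S` with `crossRatio x = crossRatio y`, `x, y` both increasing or both
decreasing, there is `Φ : ℂ → ℂ` continuous, holomorphic on `R.carrier`, injective on its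
closure, with `S.carrier = Φ '' R.carrier`, `S.pt i = Φ (R.pt i)`, `S.arc k = Φ '' R.arc k`
(`k = 1, 2`). Construction: the real Möbius map `M` with `M xᵢ = yᵢ` (`exists_moebius_match_aux`),
`g = ψ ∘ M ∘ φ⁻¹ : R → S`; the Carathéodory extensions `Ψ₁` of `φ ∘ C⁻¹ : 𝔻 → R` and `Ψ₂` of
`g ∘ φ ∘ C⁻¹ : 𝔻 → S` (`JordanDomain.exists_continuousOn_extension_holds`) give
`Φ₀ = Ψ₂ ∘ Ψ₁⁻¹` on `closure R`, extended to the plane by Tietze; the side correspondence is the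
elementary fact that a connected subset of a Jordan curve with four marks containing two
consecutive marks and avoiding the other two contains the arc between them
(`ArcLemmas.arc_two_subset`, `arc_one_subset`).

## References

Ch. Pommerenke, *Boundary Behaviour of Conformal Maps* (1992), Thm. 2.6, §2.3 Ex. 2; L. V. Ahlfors,
*Complex Analysis*, 3rd ed. (1979), Ch. 3 §3, Ch. 6 §1.1.
-/

noncomputable section

namespace Summit.CriticalPhenomena.CardyFormulaZ2.Theorems.SymmetryUpgradeR.SwallowingSkeleton

open Filter Set Metric Topology
open Literature.Probability.RandomPlanarGeometry
open UpperHalfPlane (upperHalfPlaneSet)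

/-! ### Arcs of a Jordan curve through connected subsets -/

/-- The boundary loop of a Jordan domain is injective on every shifted period `[u, u + 1)` with
`0 ≤ u < 1` (reduce to the fundamental period `[0, 1)`). -/
theorem injOn_boundary_Ico_shift (D : JordanDomain) {u : ℝ} (hu0 : 0 ≤ u) (hu1 : u < 1) :
    InjOn D.boundary (Ico u (u + 1)) := by
  have red : ∀ s ∈ Ico u (u + 1),
      ∃ s' ∈ Ico (0 : ℝ) 1, D.boundary s' = D.boundary s ∧ (s' = s ∨ s' = s - 1) := by
    intro s hs
    by_cases hs1 : s < 1
    · exact ⟨s, ⟨hu0.trans hs.1, hs1⟩, rfl, Or.inl rfl⟩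
    · refine ⟨s - 1, ⟨by linarith, by linarith [hs.2]⟩, ?_, Or.inr rfl⟩
      have := D.periodic_boundary (s - 1)
      rw [sub_add_cancel] at this
      exact this.symm
  intro s hs s' hs' heq
  obtain ⟨w, hw, hbw, hcase⟩ := red s hs
  obtain ⟨w', hw', hbw', hcase'⟩ := red s' hs'
  have hww' : w = w' := D.injOn_boundary hw hw' (by rw [hbw, hbw', heq])
  obtain ⟨hs1, hs2⟩ := hs; obtain ⟨hs'1, hs'2⟩ := hs'
  rcases hcase with h | h <;> rcases hcase' with h' | h' <;> subst h <;> linarith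

/-- **A connected subset of a Jordan curve through `∂D(s)`, `∂D(t)` avoiding `∂D(u)`, `∂D(v)`
(`0 ≤ u ≤ s ≤ t ≤ v < u + 1`, `u < 1`) contains `∂D([s, t])`**: `∂D = ∂D([u, v]) ∪ ∂D([v, u+1])`,
two closed sets meeting only in the avoided points, so `C ⊆ ∂D([u, v])`, on which the loop is a
homeomorphism; a preconnected subset of `ℝ` through `s, t` contains `[s, t]`. -/
theorem image_Icc_subset_of_isPreconnected (D : JordanDomain) {u v s t : ℝ} (hu0 : 0 ≤ u)
    (hu1 : u < 1) (hus : u ≤ s) (hst : s ≤ t) (htv : t ≤ v) (hvu : v < u + 1) {C : Set ℂ}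
    (hC : IsPreconnected C) (hCf : C ⊆ frontier D.carrier) (hs : D.boundary s ∈ C)
    (ht : D.boundary t ∈ C) (hu : D.boundary u ∉ C) (hv : D.boundary v ∉ C) :
    D.boundary '' Icc s t ⊆ C := by
  have hinj : InjOn D.boundary (Ico u (u + 1)) := injOn_boundary_Ico_shift D hu0 hu1
  have huv : u ≤ v := hus.trans (hst.trans htv)
  set F₂ : Set ℂ := D.boundary '' Icc u v with hF₂def
  set F₁ : Set ℂ := D.boundary '' Icc v (u + 1) with hF₁def
  have hF₁ : IsClosed F₁ := (isCompact_Icc.image D.continuous_boundary).isClosed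
  have hF₂ : IsClosed F₂ := (isCompact_Icc.image D.continuous_boundary).isClosed
  have hcover : C ⊆ F₂ ∪ F₁ := by
    intro z hz
    have hz' := hCf hz
    rw [← D.range_boundary] at hz'
    obtain ⟨r, rfl⟩ := hz'
    obtain ⟨r', hr', hrr'⟩ := D.periodic_boundary.exists_mem_Ico one_pos r u
    rw [hrr']
    rcases le_total r' v with h | h
    · exact Or.inl ⟨r', ⟨hr'.1, h⟩, rfl⟩
    · exact Or.inr ⟨r', ⟨h, hr'.2.le⟩, rfl⟩
  -- a common point of `F₂` and `F₁` is `∂D(u)` or `∂D(v)`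
  have hcommon : ∀ {p q : ℝ}, p ∈ Icc u v → q ∈ Icc v (u + 1) → D.boundary q = D.boundary p →
      D.boundary p = D.boundary u ∨ p = v := by
    intro p q hp hq hpq
    rcases hq.2.lt_or_eq with hq1 | hq1
    · have hqp : q = p := hinj ⟨huv.trans hq.1, hq1⟩ ⟨hp.1, hp.2.trans_lt hvu⟩ hpq
      exact Or.inr (le_antisymm hp.2 (hqp ▸ hq.1))
    · left
      rw [← hpq, hq1]
      exact D.periodic_boundary u
  have hdisj : C ∩ (F₂ ∩ F₁) = ∅ := by
    refine eq_empty_iff_forall_notMem.2 ?_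
    rintro z ⟨hzC, ⟨p, hp, rfl⟩, ⟨q, hq, hpq⟩⟩
    rcases hcommon hp hq hpq with h | h
    · exact hu (h ▸ hzC)
    · exact hv (h ▸ hzC)
  have hC2 : C ⊆ F₂ := by
    rcases (isPreconnected_iff_subset_of_disjoint_closed.1 hC) F₂ F₁ hF₂ hF₁ hcover hdisj with
      h | h
    · exact h
    · exfalso
      obtain ⟨q, hq, hqs⟩ := h hs
      rcases hcommon ⟨hus, hst.trans htv⟩ hq hqs with h' | h'
      · exact hu (h' ▸ hs)
      · exact hv (h' ▸ hs)
  -- invert the loop on `[u, v]`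
  have hinj' : InjOn D.boundary (Icc u v) := hinj.mono (Icc_subset_Ico_right hvu)
  have hcont : ContinuousOn (Function.invFunOn D.boundary (Icc u v)) F₂ :=
    continuousOn_invFunOn_of_isCompact isCompact_Icc D.continuous_boundary.continuousOn
      hinj'.bijOn_image
  set T : Set ℝ := Function.invFunOn D.boundary (Icc u v) '' C with hTdef
  have hT : IsPreconnected T := hC.image _ (hcont.mono hC2)
  have hleft : ∀ r ∈ Icc u v, Function.invFunOn D.boundary (Icc u v) (D.boundary r) = r :=
    fun r hr => hinj'.leftInvOn_invFunOn hr
  have hsT : s ∈ T := ⟨D.boundary s, hs, hleft s ⟨hus, hst.trans htv⟩⟩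
  have htT : t ∈ T := ⟨D.boundary t, ht, hleft t ⟨hus.trans hst, htv⟩⟩
  have hIcc : Icc s t ⊆ T := hT.Icc_subset hsT htT
  rintro _ ⟨r, hr, rfl⟩
  obtain ⟨z, hzC, hzr⟩ := hIcc hr
  have hz : D.boundary (Function.invFunOn D.boundary (Icc u v) z) = z :=
    Function.invFunOn_eq (hC2 hzC)
  rw [hzr] at hz
  rwa [hz]

namespace ArcLemmas

variable (S : ConformalRectangle)

/-- `S.arc 1 = ∂S([mark 1, mark 2])`. -/
theorem arc_one_eq : S.arc 1 = S.boundary '' Icc (S.mark 1) (S.mark 2) := by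
  rw [MarkedDomain.arc, S.nextMark_of_lt 1 (by decide)]
  rfl

/-- `S.arc 2 = ∂S([mark 2, mark 3])`. -/
theorem arc_two_eq : S.arc 2 = S.boundary '' Icc (S.mark 2) (S.mark 3) := by
  rw [MarkedDomain.arc, S.nextMark_of_lt 2 (by decide)]
  rfl

/-- **A connected subset of `∂S` through `c, d` avoiding `a, b` contains the arc `(cd)`.** -/
theorem arc_two_subset {C : Set ℂ} (hC : IsPreconnected C) (hCf : C ⊆ frontier S.carrier)
    (h2 : S.pt 2 ∈ C) (h3 : S.pt 3 ∈ C) (h0 : S.pt 0 ∉ C) (h1 : S.pt 1 ∉ C) : S.arc 2 ⊆ C := by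
  have m12 : S.mark 1 < S.mark 2 := S.strictMono_mark (by decide)
  have m23 : S.mark 2 < S.mark 3 := S.strictMono_mark (by decide)
  have m30 : S.mark 3 ≤ S.mark 0 + 1 := by linarith [(S.mark_mem 3).2, (S.mark_mem 0).1]
  have h0' : S.boundary (S.mark 0 + 1) ∉ C := by rw [S.periodic_boundary (S.mark 0)]; exact h0
  rw [arc_two_eq]
  exact image_Icc_subset_of_isPreconnected S.toJordanDomain (u := S.mark 1) (v := S.mark 0 + 1)
    (s := S.mark 2) (t := S.mark 3) (S.mark_mem 1).1 (S.mark_mem 1).2 m12.le m23.le m30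
    (by linarith [S.strictMono_mark (show (0 : Fin 4) < 1 by decide)]) hC hCf h2 h3 h1 h0'

/-- **A connected subset of `∂S` through `b, c` avoiding `d, a` contains the arc `(bc)`.** -/
theorem arc_one_subset {C : Set ℂ} (hC : IsPreconnected C) (hCf : C ⊆ frontier S.carrier)
    (h1 : S.pt 1 ∈ C) (h2 : S.pt 2 ∈ C) (h3 : S.pt 3 ∉ C) (h0 : S.pt 0 ∉ C) : S.arc 1 ⊆ C := by
  have m12 : S.mark 1 < S.mark 2 := S.strictMono_mark (by decide)
  have m23 : S.mark 2 < S.mark 3 := S.strictMono_mark (by decide)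
  have m01 : S.mark 0 < S.mark 1 := S.strictMono_mark (by decide)
  have m30 : S.mark 3 < S.mark 0 + 1 := by linarith [(S.mark_mem 3).2, (S.mark_mem 0).1]
  rw [arc_one_eq]
  exact image_Icc_subset_of_isPreconnected S.toJordanDomain (u := S.mark 0) (v := S.mark 3)
    (s := S.mark 1) (t := S.mark 2) (S.mark_mem 0).1 (S.mark_mem 0).2 m01.le m12.le m23.le m30
    hC hCf h1 h2 h0 h3

/-- **Side correspondence of a boundary map with vertex correspondence.** If `h` is continuous
and injective on `∂R`, maps `∂R` into `∂S` and the four marks to the four marks, then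
`S.arc 1 ⊆ h '' R.arc 1` and `S.arc 2 ⊆ h '' R.arc 2`. -/
theorem arc_subset_image (R : ConformalRectangle) {h : ℂ → ℂ}
    (hc : ContinuousOn h (frontier R.carrier)) (hi : InjOn h (frontier R.carrier))
    (hmaps : MapsTo h (frontier R.carrier) (frontier S.carrier)) (hpt : ∀ i, h (R.pt i) = S.pt i) :
    S.arc 1 ⊆ h '' R.arc 1 ∧ S.arc 2 ⊆ h '' R.arc 2 := by
  have hconn : ∀ k, IsPreconnected (h '' R.arc k) := fun k =>
    (isPreconnected_Icc.image _ (R.continuous_boundary.continuousOn)).image _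
      (hc.mono (R.arc_subset_frontier k))
  have hsub : ∀ k, h '' R.arc k ⊆ frontier S.carrier := fun k =>
    (image_mono (R.arc_subset_frontier k)).trans hmaps.image_subset
  have hmem : ∀ {k m : Fin 4}, R.pt m ∈ R.arc k → S.pt m ∈ h '' R.arc k := fun {k m} hm =>
    ⟨R.pt m, hm, hpt m⟩
  have hnot : ∀ {k m : Fin 4}, R.pt m ∉ R.arc k → S.pt m ∉ h '' R.arc k := by
    intro k m hm ⟨z, hz, hzm⟩
    rw [← hpt m] at hzm
    have : z = R.pt m := hi (R.arc_subset_frontier k hz) (R.pt_mem_frontier m) hzm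
    exact hm (this ▸ hz)
  have hin : ∀ {k m : Fin 4}, (m = k ∨ m = k + 1) → R.pt m ∈ R.arc k := fun h =>
    (R.pt_mem_arc_iff).2 h
  have hout : ∀ {k m : Fin 4}, ¬ (m = k ∨ m = k + 1) → R.pt m ∉ R.arc k := fun h h' =>
    h ((R.pt_mem_arc_iff).1 h')
  refine ⟨arc_one_subset S (hconn 1) (hsub 1) (hmem (hin (by decide))) (hmem (hin (by decide)))
      (hnot (hout (by decide))) (hnot (hout (by decide))),
    arc_two_subset S (hconn 2) (hsub 2) (hmem (hin (by decide))) (hmem (hin (by decide)))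
      (hnot (hout (by decide))) (hnot (hout (by decide)))⟩

end ArcLemmas

/-! ### Two conformal rectangles with the same modulus and the same orientation -/

/-- **Möbius matching, pointwise** (Ahlfors 1979, Ch. 3 §3): two increasing (or two decreasing)
real quadruples with the same Cardy cross-ratio are related by a real Möbius map of positive
determinant, `ξᵢ ↦ yᵢ`, the pole off the points (`exists_moebius_match_aux`). -/
theorem exists_moebius_pointwise (ξ y : Fin 4 → ℝ)
    (hor : (StrictMono ξ ∧ StrictMono y) ∨ (StrictAnti ξ ∧ StrictAnti y))
    (hcr : crossRatio ξ = crossRatio y) :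
    ∃ a b c d : ℝ, 0 < a * d - b * c ∧
      ∀ i, c * ξ i + d ≠ 0 ∧ (a * ξ i + b) / (c * ξ i + d) = y i := by
  have i01 : (0 : Fin 4) < 1 := by decide
  have i12 : (1 : Fin 4) < 2 := by decide
  have i23 : (2 : Fin 4) < 3 := by decide
  have hiξ : Function.Injective ξ :=
    hor.elim (fun h => h.1.injective) (fun h => h.1.injective)
  have hiy : Function.Injective y :=
    hor.elim (fun h => h.2.injective) (fun h => h.2.injective)
  have hQ : (ξ 0 - ξ 2) * (ξ 1 - ξ 3) ≠ 0 :=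
    mul_ne_zero (sub_ne_zero.2 (hiξ.ne (by decide))) (sub_ne_zero.2 (hiξ.ne (by decide)))
  have hQ' : (y 0 - y 2) * (y 1 - y 3) ≠ 0 :=
    mul_ne_zero (sub_ne_zero.2 (hiy.ne (by decide))) (sub_ne_zero.2 (hiy.ne (by decide)))
  have hPQ : (ξ 0 - ξ 1) * (ξ 2 - ξ 3) * ((y 0 - y 2) * (y 1 - y 3)) =
      (y 0 - y 1) * (y 2 - y 3) * ((ξ 0 - ξ 2) * (ξ 1 - ξ 3)) := by
    simp only [crossRatio] at hcr
    rwa [div_eq_div_iff hQ hQ'] at hcr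
  rcases hor with ⟨hξ, hy⟩ | ⟨hξ, hy⟩
  · have x01 := hξ i01; have x12 := hξ i12; have x23 := hξ i23
    have y01 := hy i01; have y12 := hy i12; have y23 := hy i23
    obtain ⟨a, b, c, d, hdet, hval, -, -⟩ := exists_moebius_match_aux ξ y hPQ
      (mul_pos_of_neg_of_neg
        (mul_neg_of_pos_of_neg (mul_pos_of_neg_of_neg (by linarith) (by linarith)) (by linarith))
        (mul_neg_of_pos_of_neg (mul_pos_of_neg_of_neg (by linarith) (by linarith)) (by linarith)))
      (mul_pos_of_neg_of_neg (by linarith) (by linarith))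
      (mul_pos_of_neg_of_neg (by linarith) (by linarith))
      (mul_pos (by linarith) (by linarith)) (mul_pos_of_neg_of_neg (by linarith) (by linarith))
    exact ⟨a, b, c, d, hdet, hval⟩
  · have x01 := hξ i01; have x12 := hξ i12; have x23 := hξ i23
    have y01 := hy i01; have y12 := hy i12; have y23 := hy i23
    obtain ⟨a, b, c, d, hdet, hval, -, -⟩ := exists_moebius_match_aux ξ y hPQ
      (mul_pos (mul_pos (mul_pos (by linarith) (by linarith)) (by linarith))
        (mul_pos (mul_pos (by linarith) (by linarith)) (by linarith)))
      (mul_pos (by linarith) (by linarith)) (mul_pos (by linarith) (by linarith))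
      (mul_pos_of_neg_of_neg (by linarith) (by linarith)) (mul_pos (by linarith) (by linarith))
    exact ⟨a, b, c, d, hdet, hval⟩

/-- Registered helper `exitRigidity_imageDataOfModulus` (stub `stub_exitRigidity`). **Two
conformal rectangles with the same modulus and the same boundary orientation are univalent
images of one another, vertices and sides corresponding, by a map of the whole plane**
(Pommerenke 1992, §2.3 Ex. 2 with Thm. 2.6; Ahlfors 1979, Ch. 6 §1.1): see the module
docstring for the construction (`g = ψ ∘ M ∘ φ⁻¹`, `Φ₀ = Ψ₂ ∘ Ψ₁⁻¹` from two Carathéodory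
extensions, side correspondence by `ArcLemmas.arc_subset_image` for `Φ₀` and `Φ₀⁻¹`, Tietze). -/
theorem exitRigidity_imageDataOfModulus : ∀ (R S : ConformalRectangle) (φ : ConformalEquiv upperHalfPlaneSet R.carrier) (ψ : ConformalEquiv upperHalfPlaneSet S.carrier) (x y : Fin 4 → ℝ), R.IsUniformizing φ x → S.IsUniformizing ψ y → (StrictMono x ∧ StrictMono y) ∨ (StrictAnti x ∧ StrictAnti y) → crossRatio x = crossRatio y → ∃ Φ : C(ℂ, ℂ), DifferentiableOn ℂ Φ R.carrier ∧ Set.InjOn Φ (closure R.carrier) ∧ S.carrier = Φ '' R.carrier ∧ (∀ i, S.pt i = Φ (R.pt i)) ∧ S.arc 1 = Φ '' R.arc 1 ∧ S.arc 2 = Φ '' R.arc 2 := by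
  intro R S φ ψ x y hφ hψ hor hcr
  -- (1) the Möbius matching and the conformal map `g = ψ ∘ M ∘ φ⁻¹ : R → S`
  obtain ⟨a, b, c, d, hdet, hval⟩ := exists_moebius_pointwise x y hor hcr
  obtain ⟨M, hM, -⟩ := exists_moebius_conformalEquiv hdet
  set g : ConformalEquiv R.carrier S.carrier := φ.symm.trans (M.trans ψ) with hgdef
  obtain ⟨Ψ₁, hΨ₁c, hΨ₁eq, hΨ₁bij, hΨ₁sph⟩ :=
    JordanDomain.exists_continuousOn_extension_holds R.toJordanDomain (cayley.symm.trans φ)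
  -- (2) boundary values of `g` at the marks
  have hgbv : ∀ i, Tendsto g (𝓝[R.carrier] (R.pt i)) (𝓝 (S.pt i)) := by
    intro i
    have h1 : Tendsto φ.symm (𝓝[R.carrier] (R.pt i)) (𝓝[upperHalfPlaneSet] (x i : ℂ)) :=
      tendsto_nhdsWithin_iff.2
        ⟨JordanDomain.tendsto_symm_nhds φ hΨ₁c hΨ₁eq hΨ₁bij.injOn (hφ.2 i),
          eventually_nhdsWithin_of_forall fun w hw => φ.symm_mapsTo hw⟩
    have h2 := moebius_tendsto_ofReal hdet (hval i).1
    rw [(hval i).2] at h2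
    have h3 : Tendsto ψ (𝓝[upperHalfPlaneSet] (y i : ℂ)) (𝓝 (S.pt i)) := hψ.2 i
    refine (h3.comp (h2.comp h1)).congr fun w => ?_
    simp only [Function.comp_apply, hgdef, ConformalEquiv.trans_apply, hM]
  -- (3) the homeomorphism `Φ₀ = Ψ₂ ∘ Ψ₁⁻¹ : closure R → closure S` and its inverse
  obtain ⟨Ψ₂, hΨ₂c, hΨ₂eq, hΨ₂bij, hΨ₂sph⟩ :=
    JordanDomain.exists_continuousOn_extension_holds S.toJordanDomain
      ((cayley.symm.trans φ).trans g)
  set inv₁ : ℂ → ℂ := Function.invFunOn Ψ₁ (closedBall (0 : ℂ) 1) with hinv₁def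
  have hinv₁c : ContinuousOn inv₁ (closure R.carrier) :=
    continuousOn_invFunOn_of_isCompact (isCompact_closedBall 0 1) hΨ₁c hΨ₁bij
  have hinv₁maps : MapsTo inv₁ (closure R.carrier) (closedBall 0 1) :=
    hΨ₁bij.surjOn.mapsTo_invFunOn
  have hΨ₁inv₁ : ∀ w ∈ closure R.carrier, Ψ₁ (inv₁ w) = w := fun w hw =>
    hΨ₁bij.invOn_invFunOn.2 hw
  have hinv₁Ψ₁ : ∀ ζ ∈ closedBall (0 : ℂ) 1, inv₁ (Ψ₁ ζ) = ζ := fun ζ hζ =>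
    hΨ₁bij.invOn_invFunOn.1 hζ
  set inv₂ : ℂ → ℂ := Function.invFunOn Ψ₂ (closedBall (0 : ℂ) 1) with hinv₂def
  have hinv₂c : ContinuousOn inv₂ (closure S.carrier) :=
    continuousOn_invFunOn_of_isCompact (isCompact_closedBall 0 1) hΨ₂c hΨ₂bij
  have hinv₂maps : MapsTo inv₂ (closure S.carrier) (closedBall 0 1) :=
    hΨ₂bij.surjOn.mapsTo_invFunOn
  have hΨ₂inv₂ : ∀ w ∈ closure S.carrier, Ψ₂ (inv₂ w) = w := fun w hw =>
    hΨ₂bij.invOn_invFunOn.2 hw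
  have hinv₂Ψ₂ : ∀ ζ ∈ closedBall (0 : ℂ) 1, inv₂ (Ψ₂ ζ) = ζ := fun ζ hζ =>
    hΨ₂bij.invOn_invFunOn.1 hζ
  set Φ₀ : ℂ → ℂ := fun w => Ψ₂ (inv₁ w) with hΦ₀def
  set Φinv : ℂ → ℂ := fun w => Ψ₁ (inv₂ w) with hΦinvdef
  have hΦ₀c : ContinuousOn Φ₀ (closure R.carrier) := hΨ₂c.comp hinv₁c hinv₁maps
  have hΦinvc : ContinuousOn Φinv (closure S.carrier) := hΨ₁c.comp hinv₂c hinv₂maps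
  have hΦ₀inj : InjOn Φ₀ (closure R.carrier) := by
    intro w hw w' hw' h
    have h' : inv₁ w = inv₁ w' := hΨ₂bij.injOn (hinv₁maps hw) (hinv₁maps hw') h
    rw [← hΨ₁inv₁ w hw, ← hΨ₁inv₁ w' hw', h']
  have hΦinvinj : InjOn Φinv (closure S.carrier) := by
    intro w hw w' hw' h
    have h' : inv₂ w = inv₂ w' := hΨ₁bij.injOn (hinv₂maps hw) (hinv₂maps hw') h
    rw [← hΨ₂inv₂ w hw, ← hΨ₂inv₂ w' hw', h']
  have hΦ₀Φinv : ∀ w ∈ closure S.carrier, Φ₀ (Φinv w) = w := by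
    intro w hw
    show Ψ₂ (inv₁ (Ψ₁ (inv₂ w))) = w
    rw [hinv₁Ψ₁ _ (hinv₂maps hw), hΨ₂inv₂ w hw]
  -- `Φ₀ = g` on the open domain
  have hball : ∀ w ∈ R.carrier, inv₁ w ∈ ball (0 : ℂ) 1 := by
    intro w hw
    have hζ : inv₁ w ∈ closedBall (0 : ℂ) 1 := hinv₁maps (subset_closure hw)
    by_contra hnot
    have hsph : inv₁ w ∈ sphere (0 : ℂ) 1 := by
      rw [mem_sphere_zero_iff_norm]
      exact le_antisymm (mem_closedBall_zero_iff.1 hζ)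
        (not_lt.1 fun h => hnot (mem_ball_zero_iff.2 h))
    have hfr : w ∈ frontier R.carrier := by
      rw [← hΨ₁inv₁ w (subset_closure hw)]
      exact hΨ₁sph.mapsTo hsph
    have hmem : w ∈ R.carrier ∩ frontier R.carrier := ⟨hw, hfr⟩
    rw [R.isOpen.inter_frontier_eq] at hmem
    exact Set.notMem_empty w hmem
  have hΦ₀g : EqOn Φ₀ g R.carrier := by
    intro w hw
    have hζ := hball w hw
    calc Φ₀ w = ((cayley.symm.trans φ).trans g) (inv₁ w) := hΨ₂eq hζ
      _ = g ((cayley.symm.trans φ) (inv₁ w)) := rfl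
      _ = g (Ψ₁ (inv₁ w)) := by rw [hΨ₁eq hζ]
      _ = g w := by rw [hΨ₁inv₁ w (subset_closure hw)]
  -- marks to marks, in both directions
  have hΦ₀pt : ∀ i, Φ₀ (R.pt i) = S.pt i := by
    intro i
    have hmem : R.pt i ∈ closure R.carrier := frontier_subset_closure (R.pt_mem_frontier i)
    haveI : (𝓝[R.carrier] (R.pt i)).NeBot := mem_closure_iff_nhdsWithin_neBot.1 hmem
    have h1 : Tendsto Φ₀ (𝓝[R.carrier] (R.pt i)) (𝓝 (Φ₀ (R.pt i))) :=
      ((hΦ₀c (R.pt i) hmem).mono subset_closure).tendsto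
    have h2 : Tendsto g (𝓝[R.carrier] (R.pt i)) (𝓝 (Φ₀ (R.pt i))) :=
      h1.congr' (eventually_nhdsWithin_of_forall fun w hw => hΦ₀g hw)
    exact tendsto_nhds_unique h2 (hgbv i)
  have hΦinvpt : ∀ i, Φinv (S.pt i) = R.pt i := by
    intro i
    have hmem : R.pt i ∈ closure R.carrier := frontier_subset_closure (R.pt_mem_frontier i)
    rw [← hΦ₀pt i]
    show Ψ₁ (inv₂ (Ψ₂ (inv₁ (R.pt i)))) = R.pt i
    rw [hinv₂Ψ₂ _ (hinv₁maps hmem), hΨ₁inv₁ _ hmem]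
  -- boundary to boundary, in both directions
  have hΦ₀fr : MapsTo Φ₀ (frontier R.carrier) (frontier S.carrier) := by
    intro z hz
    obtain ⟨ζ, hζ, rfl⟩ := hΨ₁sph.surjOn hz
    show Ψ₂ (inv₁ (Ψ₁ ζ)) ∈ frontier S.carrier
    rw [hinv₁Ψ₁ ζ (sphere_subset_closedBall hζ)]
    exact hΨ₂sph.mapsTo hζ
  have hΦinvfr : MapsTo Φinv (frontier S.carrier) (frontier R.carrier) := by
    intro z hz
    obtain ⟨ζ, hζ, rfl⟩ := hΨ₂sph.surjOn hz
    show Ψ₁ (inv₂ (Ψ₂ ζ)) ∈ frontier R.carrier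
    rw [hinv₂Ψ₂ ζ (sphere_subset_closedBall hζ)]
    exact hΨ₁sph.mapsTo hζ
  -- sides to sides
  obtain ⟨hS1, hS2⟩ := ArcLemmas.arc_subset_image S R (hΦ₀c.mono frontier_subset_closure)
    (hΦ₀inj.mono frontier_subset_closure) hΦ₀fr hΦ₀pt
  obtain ⟨hR1, hR2⟩ := ArcLemmas.arc_subset_image R S (hΦinvc.mono frontier_subset_closure)
    (hΦinvinj.mono frontier_subset_closure) hΦinvfr hΦinvpt
  have harc : ∀ k, S.arc k ⊆ Φ₀ '' R.arc k → R.arc k ⊆ Φinv '' S.arc k →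
      S.arc k = Φ₀ '' R.arc k := by
    intro k h h'
    refine h.antisymm ?_
    rintro _ ⟨z, hz, rfl⟩
    obtain ⟨w, hw, rfl⟩ := h' hz
    rw [hΦ₀Φinv w (((S.arc_subset_frontier k).trans frontier_subset_closure) hw)]
    exact hw
  -- (4) Tietze extension to the plane
  obtain ⟨Φ, hΦ⟩ := ContinuousMap.exists_restrict_eq (Y := ℂ) isClosed_closure
    ⟨(closure R.carrier).restrict Φ₀, hΦ₀c.restrict⟩
  have hΦΦ₀ : EqOn Φ Φ₀ (closure R.carrier) := fun w hw => by
    have := congrArg (fun f => f ⟨w, hw⟩) hΦ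
    simpa using this
  refine ⟨Φ, ?_, ?_, ?_, ?_, ?_, ?_⟩
  · exact g.differentiableOn_coe.congr fun w hw => (hΦΦ₀ (subset_closure hw)).trans (hΦ₀g hw)
  · intro w hw w' hw' h
    rw [hΦΦ₀ hw, hΦΦ₀ hw'] at h
    exact hΦ₀inj hw hw' h
  · rw [(hΦΦ₀.mono subset_closure).image_eq, hΦ₀g.image_eq, g.bijOn.image_eq]
  · intro i
    rw [hΦΦ₀ (frontier_subset_closure (R.pt_mem_frontier i)), hΦ₀pt i]
  · rw [(hΦΦ₀.mono ((R.arc_subset_frontier 1).trans frontier_subset_closure)).image_eq]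
    exact harc 1 hS1 hR1
  · rw [(hΦΦ₀.mono ((R.arc_subset_frontier 2).trans frontier_subset_closure)).image_eq]
    exact harc 2 hS2 hR2

end Summit.CriticalPhenomena.CardyFormulaZ2.Theorems.SymmetryUpgradeR.SwallowingSkeleton
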